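import Mathlib.Analysis.Convex.KreinMilman
import Mathlib.Analysis.InnerProductSpace.Dual
import Mathlib.Analysis.LocallyConvex.Separation
import Literature.Geometry.DiscreteGeometry.ConeTiling
import HarnessLib

/-!
# The facets of the convex hull of a finite point set (Minkowski–Weyl with `0` in the interior)

Topic `Literature/Geometry/DiscreteGeometry`.  Brick B of the face theory of spherical
subdivisions (Musin–Tarasov 2012 §3; Legendre's proof of Euler's formula), usable for any
polytope: the passage from the vertex description `conv X` of the convex hull of a finite set
`X` in a finite-dimensional real inner product space `E`, with `0` in its interior, to its FACET
description.  Everything is PROVED; no named facts.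

* `tightSet X c = {y ∈ X | ⟪c, y⟫ = 1}`; `IsFacetNormal X c`: `⟪c, y⟫ ≤ 1` on `X` and the
  tight set spans `E` linearly (equivalently: affinely spans the hyperplane `⟪c, ·⟫ = 1`,
  which misses `0`) — `c` is the normal of a facet of `conv X`, scaled so that the facet lies in
  `⟪c, ·⟫ = 1`; `facetNormals X`, a `Finset` (`finite_setOf_isFacetNormal`: a facet normal is
  determined by its tight set, `IsFacetNormal.eq_of_tightSet_eq`).
* **Minkowski–Weyl** (`exists_isFacetNormal_one_lt_inner`, `convexHull_eq_setOf_inner_le_one`):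
  if `0 ∈ interior (conv X)` then every point outside `conv X` violates a FACET inequality, so
  `conv X = {x | ⟪c, x⟫ ≤ 1 for all c ∈ facetNormals X}`.  Proof: separate `x` from the compact
  convex `conv X` by `⟪c₀, ·⟫ < 1 < ⟪c₀, x⟫` (Hahn–Banach + Riesz); the polar
  `P = {c | ⟪c, y⟫ ≤ 1 ∀ y ∈ X}` is compact because `conv X` contains a ball about `0`; the face
  of `P` where `⟪·, x⟫` is maximal has an extreme point `c⋆` (Krein–Milman), extreme in `P`; an
  extreme point of `P` has a spanning tight set (otherwise `c⋆ ± εd` with `d ⊥ span (tight set)`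
  stay in `P`), i.e. `c⋆` is a facet normal with `⟪c⋆, x⟫ ≥ ⟪c₀, x⟫ > 1`.
* Consequences: `facetNormals_nonempty`; `exists_inner_eq_one_of_not_mem_interior` (a point of
  `conv X` off its interior lies on a facet); `inner_le_one_of_mem_convexHull`,
  `mem_convexHull_tightSet` (the face cut out by `⟪c, ·⟫ = 1` is the hull of the tight set);
  `exists_inner_pos` (for `x ≠ 0` some facet functional is positive: the gauge is positive);
  and the identification of the facet fan with the argmax cones of `ConeTiling.lean`:
  `argmaxCone (facetNormals X) c = ℝ≥0 · conv (tightSet X c)` (`argmaxCone_facetNormals_eq`),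
  `mem_argmaxCone_facetNormals_iff` (for a point `y ∈ conv X` on some facet:
  `y ∈ argmaxCone F c ↔ ⟪c, y⟫ = 1`).

With `ConeTiling.sum_ballFraction_argmaxCone` this gives: the solid angles at `0` of the cones
over the facets of `conv X` sum to the full solid angle, and along each vertex ray the dihedral
angles of the facet cones sum to `2π` (`sum_ballFraction_dirCone_argmaxCone`).

## References
* H. Minkowski (1896) / H. Weyl (1935): a polytope is a bounded intersection of finitely many
  half-spaces, the facet-defining ones sufficing; G. M. Ziegler, *Lectures on Polytopes*,
  GTM 152, Thm. 1.1 and §2.2. [folklore]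
* O. R. Musin, A. S. Tarasov, *The strong thirteen spheres problem*, DCG 48 (2012), §3.
  [`MusinTarasov2012`]
-/

noncomputable section

namespace Literature.Geometry.DiscreteGeometry

open Real RealInnerProductSpace Metric Set

variable {E : Type*} [NormedAddCommGroup E] [InnerProductSpace ℝ E]

/-! ### Tight sets and facet normals -/

open Classical in
/-- **The tight set** of `c`: the points `y ∈ X` with `⟪c, y⟫ = 1`. [folklore] -/
def tightSet (X : Finset E) (c : E) : Finset E :=
  X.filter fun y => ⟪c, y⟫ = 1

/-- Membership in the tight set. [folklore] -/
theorem mem_tightSet {X : Finset E} {c y : E} : y ∈ tightSet X c ↔ y ∈ X ∧ ⟪c, y⟫ = 1 := by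
  unfold tightSet
  rw [Finset.mem_filter]

/-- The tight set is a subset of `X`. [folklore] -/
theorem tightSet_subset (X : Finset E) (c : E) : tightSet X c ⊆ X :=
  fun _ h => (mem_tightSet.1 h).1

/-- **Facet normals** of `conv X` (normalised to `⟪c, ·⟫ = 1` on the facet, which requires `0`
off the facet hyperplane): `⟪c, y⟫ ≤ 1` on `X`, and the tight set spans `E`. [folklore] -/
def IsFacetNormal (X : Finset E) (c : E) : Prop :=
  (∀ y ∈ X, ⟪c, y⟫ ≤ 1) ∧ Submodule.span ℝ ((tightSet X c : Finset E) : Set E) = ⊤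

/-- A facet normal is determined by its tight set. [folklore] -/
theorem IsFacetNormal.eq_of_tightSet_eq {X : Finset E} {c₁ c₂ : E} (h₁ : IsFacetNormal X c₁)
    (h : tightSet X c₁ = tightSet X c₂) : c₁ = c₂ := by
  have horth : ∀ y ∈ ((tightSet X c₁ : Finset E) : Set E), ⟪y, c₁ - c₂⟫ = 0 := by
    intro y hy
    have hy₁ := (mem_tightSet.1 (Finset.mem_coe.1 hy)).2
    have hy₂ := (mem_tightSet.1 (h ▸ Finset.mem_coe.1 hy)).2
    rw [real_inner_comm, inner_sub_left, hy₁, hy₂, sub_self]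
  have hmem : c₁ - c₂ ∈ (Submodule.span ℝ ((tightSet X c₁ : Finset E) : Set E))ᗮ := by
    rw [Submodule.mem_orthogonal]
    intro u hu
    exact Submodule.span_induction horth (by simp)
      (fun x y _ _ hx hy => by rw [inner_add_left, hx, hy, add_zero])
      (fun a x _ hx => by rw [real_inner_smul_left, hx, mul_zero]) hu
  rw [h₁.2, Submodule.top_orthogonal_eq_bot, Submodule.mem_bot, sub_eq_zero] at hmem
  exact hmem

/-- The set of facet normals is finite (it injects into the power set of `X`). [folklore] -/
theorem finite_setOf_isFacetNormal (X : Finset E) : {c : E | IsFacetNormal X c}.Finite := by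
  refine Set.Finite.of_finite_image (f := tightSet X) ?_ ?_
  · refine (X.powerset.finite_toSet).subset ?_
    rintro T ⟨c, -, rfl⟩
    exact Finset.mem_coe.2 (Finset.mem_powerset.2 (tightSet_subset X c))
  · intro c₁ h₁ c₂ _ h
    exact h₁.eq_of_tightSet_eq h

/-- **The facet normals of `conv X`**, as a `Finset`. [folklore] -/
def facetNormals (X : Finset E) : Finset E :=
  (finite_setOf_isFacetNormal X).toFinset

/-- Membership in `facetNormals`. [folklore] -/
theorem mem_facetNormals {X : Finset E} {c : E} : c ∈ facetNormals X ↔ IsFacetNormal X c := by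
  unfold facetNormals
  rw [Set.Finite.mem_toFinset, mem_setOf_eq]

/-- A facet has at least `dim E` vertices. [folklore] -/
theorem IsFacetNormal.finrank_le_card [FiniteDimensional ℝ E] {X : Finset E} {c : E}
    (hc : IsFacetNormal X c) : Module.finrank ℝ E ≤ (tightSet X c).card := by
  have h := finrank_span_finset_le_card (R := ℝ) (tightSet X c)
  rwa [Set.finrank, hc.2, finrank_top] at h

/-! ### Linear functionals on the hull -/

/-- A linear inequality valid on `X` is valid on `conv X`. [folklore] -/
theorem inner_le_of_mem_convexHull {X : Set E} {c : E} {m : ℝ} (hc : ∀ y ∈ X, ⟪c, y⟫ ≤ m)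
    {p : E} (hp : p ∈ convexHull ℝ X) : ⟪c, p⟫ ≤ m := by
  have hconv : Convex ℝ {w : E | ⟪c, w⟫ ≤ m} :=
    convex_halfSpace_le ⟨fun x y => inner_add_right _ _ _, fun a x => real_inner_smul_right _ _ _⟩ m
  exact convexHull_min (fun y hy => hc y hy) hconv hp

/-- In particular `⟪c, p⟫ ≤ 1` on `conv X` for a facet normal `c`. [folklore] -/
theorem inner_le_one_of_mem_convexHull {X : Finset E} {c : E} (hc : ∀ y ∈ X, ⟪c, y⟫ ≤ 1)
    {p : E} (hp : p ∈ convexHull ℝ (X : Set E)) : ⟪c, p⟫ ≤ 1 :=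
  inner_le_of_mem_convexHull (fun y hy => hc y (Finset.mem_coe.1 hy)) hp

/-- **The face of `conv X` cut out by a valid inequality is the hull of the tight points**:
if `⟪c, ·⟫ ≤ 1` on `X`, `p ∈ conv X` and `⟪c, p⟫ = 1`, then `p ∈ conv (tightSet X c)`.
[folklore] -/
theorem mem_convexHull_tightSet {X : Finset E} {c : E} (hc : ∀ y ∈ X, ⟪c, y⟫ ≤ 1) {p : E}
    (hp : p ∈ convexHull ℝ (X : Set E)) (hp1 : ⟪c, p⟫ = 1) :
    p ∈ convexHull ℝ ((tightSet X c : Finset E) : Set E) := by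
  obtain ⟨w, hw0, hw1, rfl⟩ := Finset.mem_convexHull'.1 hp
  -- the slack-weighted sum vanishes, so slack points carry no weight
  have hsum : ∑ y ∈ X, w y * (1 - ⟪c, y⟫) = 0 := by
    have : ⟪c, ∑ y ∈ X, w y • y⟫ = ∑ y ∈ X, w y * ⟪c, y⟫ := by
      rw [inner_sum]
      exact Finset.sum_congr rfl fun y _ => real_inner_smul_right _ _ _
    rw [this] at hp1
    simp only [mul_sub, mul_one, Finset.sum_sub_distrib, hw1, hp1, sub_self]
  have hzero : ∀ y ∈ X, ⟪c, y⟫ ≠ 1 → w y = 0 := by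
    intro y hy hy1
    have hnn : ∀ z ∈ X, 0 ≤ w z * (1 - ⟪c, z⟫) :=
      fun z hz => mul_nonneg (hw0 z hz) (sub_nonneg.2 (hc z hz))
    have h0 := (Finset.sum_eq_zero_iff_of_nonneg hnn).1 hsum y hy
    rcases mul_eq_zero.1 h0 with h | h
    · exact h
    · exact absurd (sub_eq_zero.1 h).symm hy1
  -- restrict the weights to the tight set
  have hsplit : ∑ y ∈ X, w y • y = ∑ y ∈ tightSet X c, w y • y := by
    rw [← Finset.sum_subset (tightSet_subset X c)]
    intro y hy hyt
    rw [hzero y hy (fun h1 => hyt (mem_tightSet.2 ⟨hy, h1⟩)), zero_smul]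
  have hsplit1 : ∑ y ∈ tightSet X c, w y = 1 := by
    rw [← hw1, ← Finset.sum_subset (tightSet_subset X c)]
    intro y hy hyt
    exact hzero y hy (fun h1 => hyt (mem_tightSet.2 ⟨hy, h1⟩))
  rw [hsplit]
  exact Finset.mem_convexHull'.2 ⟨w, fun y hy => hw0 y (tightSet_subset X c hy), hsplit1, rfl⟩

/-! ### Minkowski–Weyl -/

section MinkowskiWeyl

variable [FiniteDimensional ℝ E]

omit [FiniteDimensional ℝ E] in
/-- The polar `{c | ⟪c, y⟫ ≤ 1 ∀ y ∈ X}` is bounded when `conv X` contains a ball about `0`.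
[folklore] -/
theorem norm_le_of_forall_inner_le_one {X : Finset E} {r : ℝ} (hr : 0 < r)
    (hball : ball (0 : E) r ⊆ convexHull ℝ (X : Set E)) {c : E} (hc : ∀ y ∈ X, ⟪c, y⟫ ≤ 1) :
    ‖c‖ ≤ 2 / r := by
  by_cases hc0 : c = 0
  · rw [hc0, norm_zero]; positivity
  have hcn : 0 < ‖c‖ := norm_pos_iff.2 hc0
  -- test against `(r/2) c/‖c‖ ∈ ball 0 r`
  have hmem : ((r / 2) * ‖c‖⁻¹) • c ∈ ball (0 : E) r := by
    rw [mem_ball, dist_zero_right, norm_smul, Real.norm_eq_abs, abs_of_pos (by positivity),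
      mul_assoc, inv_mul_cancel₀ hcn.ne', mul_one]
    linarith
  have h1 := inner_le_one_of_mem_convexHull hc (hball hmem)
  rw [real_inner_smul_right, real_inner_self_eq_norm_sq] at h1
  have h2 : (r / 2) * ‖c‖ ≤ 1 := by
    have : (r / 2) * ‖c‖⁻¹ * ‖c‖ ^ 2 = (r / 2) * ‖c‖ := by field_simp
    linarith [this]
  rw [le_div_iff₀ hr]
  linarith

/-- **Minkowski–Weyl, separation form.**  If `0 ∈ interior (conv X)` and `x ∉ conv X`, some
FACET inequality fails at `x`: there is a facet normal `c` with `⟪c, x⟫ > 1`. [folklore] -/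
theorem exists_isFacetNormal_one_lt_inner {X : Finset E}
    (h0 : (0 : E) ∈ interior (convexHull ℝ (X : Set E))) {x : E}
    (hx : x ∉ convexHull ℝ (X : Set E)) : ∃ c : E, IsFacetNormal X c ∧ 1 < ⟪c, x⟫ := by
  have hcomp : IsCompact (convexHull ℝ (X : Set E)) := Set.Finite.isCompact_convexHull (𝕜 := ℝ) X.finite_toSet
  -- Step 1: separate `x` from `conv X`: `⟪c₀, a⟫ < 1 < ⟪c₀, x⟫`
  obtain ⟨f, u, hfu, hux⟩ :=
    geometric_hahn_banach_closed_point (convex_convexHull ℝ (X : Set E)) hcomp.isClosed hx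
  have hu : 0 < u := by
    have := hfu 0 (interior_subset h0)
    rwa [map_zero] at this
  set c₀ : E := u⁻¹ • (InnerProductSpace.toDual ℝ E).symm f with hc₀
  have hc₀x : ∀ z : E, ⟪c₀, z⟫ = u⁻¹ * f z := fun z => by
    rw [hc₀, real_inner_smul_left, InnerProductSpace.toDual_symm_apply]
  have hc₀X : ∀ y ∈ X, ⟪c₀, y⟫ ≤ 1 := fun y hy => by
    rw [hc₀x]
    have := hfu y (subset_convexHull ℝ _ (Finset.mem_coe.2 hy))
    rw [inv_mul_le_iff₀ hu]; linarith
  have hc₀1 : 1 < ⟪c₀, x⟫ := by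
    rw [hc₀x, lt_inv_mul_iff₀ hu]; linarith
  -- Step 2: the polar is compact, convex, nonempty
  set P : Set E := {c | ∀ y ∈ X, ⟪c, y⟫ ≤ 1} with hP
  have hPconv : Convex ℝ P := by
    have : P = ⋂ y ∈ X, {c : E | ⟪c, y⟫ ≤ 1} := by ext c; simp [hP]
    rw [this]
    refine convex_iInter₂ fun y _ => ?_
    exact convex_halfSpace_le ⟨fun a b => inner_add_left _ _ _,
      fun a b => real_inner_smul_left _ _ _⟩ 1
  have hPclosed : IsClosed P := by
    have : P = ⋂ y ∈ X, {c : E | ⟪c, y⟫ ≤ 1} := by ext c; simp [hP]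
    rw [this]
    exact isClosed_biInter fun y _ => isClosed_le (by fun_prop) continuous_const
  obtain ⟨r, hr, hball⟩ := Metric.mem_nhds_iff.1 (mem_interior_iff_mem_nhds.1 h0)
  have hPbdd : Bornology.IsBounded P := by
    rw [isBounded_iff_forall_norm_le]
    exact ⟨2 / r, fun c hc => norm_le_of_forall_inner_le_one hr hball hc⟩
  have hPcomp : IsCompact P := Metric.isCompact_of_isClosed_isBounded hPclosed hPbdd
  have hc₀P : c₀ ∈ P := hc₀X
  -- Step 3: an extreme point of the face of `P` where `⟪·, x⟫` is maximal
  set l : E →L[ℝ] ℝ := innerSL ℝ x with hl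
  have hlz : ∀ z : E, l z = ⟪z, x⟫ := fun z => by rw [hl, innerSL_apply_apply, real_inner_comm]
  have hface : IsExposed ℝ P {c ∈ P | ∀ z ∈ P, l z ≤ l c} := fun _ => ⟨l, rfl⟩
  obtain ⟨z, hzP, hz⟩ := hPcomp.exists_isMaxOn ⟨c₀, hc₀P⟩ l.continuous.continuousOn
  obtain ⟨c, hc⟩ := (hface.isCompact hPcomp).extremePoints_nonempty ⟨z, hzP, fun w hw => hz hw⟩
  have hcext : c ∈ P.extremePoints ℝ := hface.isExtreme.extremePoints_subset_extremePoints hc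
  have hcP : c ∈ P := hcext.1
  have hcx : 1 < ⟪c, x⟫ := by
    have := hc.1.2 c₀ hc₀P
    rw [hlz, hlz] at this
    linarith
  refine ⟨c, ⟨hcP, ?_⟩, hcx⟩
  -- Step 4: an extreme point of the polar has a spanning tight set
  by_contra hspan
  set K := Submodule.span ℝ ((tightSet X c : Finset E) : Set E) with hK
  have hKorth : Kᗮ ≠ ⊥ := fun hbot => hspan (Submodule.orthogonal_eq_bot_iff.1 hbot)
  obtain ⟨d, hdK, hd0⟩ := Submodule.exists_mem_ne_zero_of_ne_bot hKorth
  have hdy : ∀ y ∈ tightSet X c, ⟪d, y⟫ = 0 := fun y hy => by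
    rw [Submodule.mem_orthogonal'] at hdK
    exact hdK y (Submodule.subset_span (Finset.mem_coe.2 hy))
  -- slack and a uniform `ε`
  set S : Finset E := X.filter fun y => ⟪c, y⟫ ≠ 1 with hS
  have hslack : ∀ y ∈ S, ⟪c, y⟫ < 1 := fun y hy => by
    rw [hS, Finset.mem_filter] at hy
    exact lt_of_le_of_ne (hcP y hy.1) hy.2
  obtain ⟨ε, hε, hεS⟩ : ∃ ε : ℝ, 0 < ε ∧ ∀ y ∈ S, ε * |⟪d, y⟫| < 1 - ⟪c, y⟫ := by
    by_cases hSne : S.Nonempty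
    · obtain ⟨y₀, hy₀, hmin⟩ :=
        S.exists_min_image (fun y => (1 - ⟪c, y⟫) / (|⟪d, y⟫| + 1)) hSne
      refine ⟨(1 - ⟪c, y₀⟫) / (|⟪d, y₀⟫| + 1), div_pos (sub_pos.2 (hslack y₀ hy₀)) (by positivity),
        fun y hy => ?_⟩
      have hle := hmin y hy
      have hlt : (1 - ⟪c, y⟫) / (|⟪d, y⟫| + 1) * |⟪d, y⟫| < 1 - ⟪c, y⟫ := by
        rw [div_mul_eq_mul_div, div_lt_iff₀ (by positivity)]
        nlinarith [sub_pos.2 (hslack y hy), abs_nonneg ⟪d, y⟫]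
      exact lt_of_le_of_lt (mul_le_mul_of_nonneg_right hle (abs_nonneg _)) hlt
    · exact ⟨1, one_pos, fun y hy => absurd ⟨y, hy⟩ hSne⟩
  -- `c ± ε d ∈ P`
  have hpm : ∀ σ : ℝ, |σ| = 1 → c + (σ * ε) • d ∈ P := by
    intro σ hσ y hy
    rw [inner_add_left, real_inner_smul_left]
    by_cases hyt : ⟪c, y⟫ = 1
    · rw [hdy y (mem_tightSet.2 ⟨hy, hyt⟩), mul_zero, add_zero]
      exact hyt.le
    · have hyS : y ∈ S := by rw [hS, Finset.mem_filter]; exact ⟨hy, hyt⟩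
      have h1 := hεS y hyS
      have h2 : σ * ε * ⟪d, y⟫ ≤ ε * |⟪d, y⟫| := by
        have : σ * ε * ⟪d, y⟫ ≤ |σ * ε * ⟪d, y⟫| := le_abs_self _
        rwa [abs_mul, abs_mul, hσ, one_mul, abs_of_pos hε] at this
      linarith
  have hplus : c + ε • d ∈ P := by simpa using hpm 1 (by simp)
  have hminus : c - ε • d ∈ P := by
    have := hpm (-1) (by simp)
    rwa [neg_one_mul, neg_smul, ← sub_eq_add_neg] at this
  -- contradiction with extremality
  have hseg : c ∈ openSegment ℝ (c - ε • d) (c + ε • d) := mem_openSegment_sub_add c (ε • d)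
  have := (mem_extremePoints.1 hcext).2 (c - ε • d) hminus (c + ε • d) hplus hseg
  have hεd : ε • d = 0 := by
    have h := this.2
    rwa [add_eq_left] at h
  rcases smul_eq_zero.1 hεd with h | h
  · exact (lt_irrefl 0) (h ▸ hε)
  · exact hd0 h

/-- **Minkowski–Weyl.**  If `0 ∈ interior (conv X)` then `conv X` is the intersection of its
facet half-spaces: `conv X = {x | ⟪c, x⟫ ≤ 1 for all c ∈ facetNormals X}`. [folklore] -/
theorem convexHull_eq_setOf_inner_le_one {X : Finset E}
    (h0 : (0 : E) ∈ interior (convexHull ℝ (X : Set E))) :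
    convexHull ℝ (X : Set E) = {x | ∀ c ∈ facetNormals X, ⟪c, x⟫ ≤ 1} := by
  ext x
  constructor
  · intro hx c hc
    exact inner_le_one_of_mem_convexHull (mem_facetNormals.1 hc).1 hx
  · intro hx
    by_contra hxX
    obtain ⟨c, hc, hcx⟩ := exists_isFacetNormal_one_lt_inner h0 hxX
    exact (lt_irrefl (1 : ℝ)) (lt_of_lt_of_le hcx (hx c (mem_facetNormals.2 hc)))

/-- **A polytope with interior points has facets** (in a nontrivial space). [folklore] -/
theorem facetNormals_nonempty [Nontrivial E] {X : Finset E}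
    (h0 : (0 : E) ∈ interior (convexHull ℝ (X : Set E))) : (facetNormals X).Nonempty := by
  have hcomp : IsCompact (convexHull ℝ (X : Set E)) := Set.Finite.isCompact_convexHull (𝕜 := ℝ) X.finite_toSet
  obtain ⟨x, hx⟩ := (ne_univ_iff_exists_notMem _).1 hcomp.ne_univ
  obtain ⟨c, hc, -⟩ := exists_isFacetNormal_one_lt_inner h0 hx
  exact ⟨c, mem_facetNormals.2 hc⟩

/-- **Boundary points lie on facets.**  A point of `conv X` not in its interior is tight for
some facet normal. [folklore] -/
theorem exists_inner_eq_one_of_not_mem_interior {X : Finset E}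
    (h0 : (0 : E) ∈ interior (convexHull ℝ (X : Set E))) {y : E}
    (hy : y ∈ convexHull ℝ (X : Set E)) (hyi : y ∉ interior (convexHull ℝ (X : Set E))) :
    ∃ c ∈ facetNormals X, ⟪c, y⟫ = 1 := by
  by_contra! hne
  have hlt : ∀ c ∈ facetNormals X, ⟪c, y⟫ < 1 := fun c hc =>
    lt_of_le_of_ne (inner_le_one_of_mem_convexHull (mem_facetNormals.1 hc).1 hy) (hne c hc)
  -- the finitely many strict inequalities persist on a neighbourhood
  have hopen : IsOpen {x : E | ∀ c ∈ facetNormals X, ⟪c, x⟫ < 1} := by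
    have : {x : E | ∀ c ∈ facetNormals X, ⟪c, x⟫ < 1} = ⋂ c ∈ facetNormals X, {x | ⟪c, x⟫ < 1} := by
      ext x; simp
    rw [this]
    exact isOpen_biInter_finset fun c _ => isOpen_lt (by fun_prop) continuous_const
  apply hyi
  rw [mem_interior]
  refine ⟨{x : E | ∀ c ∈ facetNormals X, ⟪c, x⟫ < 1}, fun x hx => ?_, hopen, hlt⟩
  rw [convexHull_eq_setOf_inner_le_one h0]
  exact fun c hc => (hx c hc).le

/-- **The gauge is positive**: for `x ≠ 0` some facet functional is positive at `x`.
[folklore] -/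
theorem exists_inner_pos {X : Finset E} (h0 : (0 : E) ∈ interior (convexHull ℝ (X : Set E)))
    {x : E} (hx : x ≠ 0) : ∃ c ∈ facetNormals X, 0 < ⟪c, x⟫ := by
  have hcomp : IsCompact (convexHull ℝ (X : Set E)) := Set.Finite.isCompact_convexHull (𝕜 := ℝ) X.finite_toSet
  obtain ⟨R, hR⟩ := hcomp.isBounded.subset_closedBall (0 : E)
  -- a large multiple of `x` leaves the hull
  have hxn : 0 < ‖x‖ := norm_pos_iff.2 hx
  set s : ℝ := (|R| + 1) / ‖x‖ with hs
  have hspos : 0 < s := by positivity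
  have hout : s • x ∉ convexHull ℝ (X : Set E) := by
    intro hin
    have := hR hin
    rw [mem_closedBall, dist_zero_right, norm_smul, Real.norm_eq_abs, abs_of_pos hspos, hs,
      div_mul_cancel₀ _ hxn.ne'] at this
    linarith [le_abs_self R]
  obtain ⟨c, hc, hcx⟩ := exists_isFacetNormal_one_lt_inner h0 hout
  refine ⟨c, mem_facetNormals.2 hc, ?_⟩
  rw [real_inner_smul_right] at hcx
  nlinarith

/-! ### The facet fan -/

omit [FiniteDimensional ℝ E] in
/-- For a point `y` of `conv X` lying on some facet, **`y` is in the argmax cone of the facet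
normal `c` iff `y` is tight for `c`** (the maximum of the facet functionals at `y` is `1`).
[folklore] -/
theorem mem_argmaxCone_facetNormals_iff {X : Finset E} {y : E}
    (hy : y ∈ convexHull ℝ (X : Set E)) (hy1 : ∃ c₀ ∈ facetNormals X, ⟪c₀, y⟫ = 1) {c : E}
    (hc : c ∈ facetNormals X) : y ∈ argmaxCone (facetNormals X) c ↔ ⟪c, y⟫ = 1 := by
  obtain ⟨c₀, hc₀, hc₀y⟩ := hy1
  constructor
  · intro h
    exact le_antisymm (inner_le_one_of_mem_convexHull (mem_facetNormals.1 hc).1 hy)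
      (hc₀y ▸ h c₀ hc₀)
  · intro h c' hc'
    rw [h]
    exact inner_le_one_of_mem_convexHull (mem_facetNormals.1 hc').1 hy

/-- **The argmax cone of a facet normal is the cone over the facet**:
`argmaxCone (facetNormals X) c = {t • p | t ≥ 0, p ∈ conv (tightSet X c)}`. [folklore] -/
theorem argmaxCone_facetNormals_eq [Nontrivial E] {X : Finset E}
    (h0 : (0 : E) ∈ interior (convexHull ℝ (X : Set E))) {c : E} (hc : c ∈ facetNormals X) :
    argmaxCone (facetNormals X) c =
      {x | ∃ t : ℝ, 0 ≤ t ∧ ∃ p ∈ convexHull ℝ ((tightSet X c : Finset E) : Set E), x = t • p} := by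
  have hcF := mem_facetNormals.1 hc
  ext x
  constructor
  · intro hx
    by_cases hx0 : x = 0
    · -- `0 = 0 • p` for any tight point `p` (the tight set is nonempty: it spans `E ≠ 0`)
      have hne : (tightSet X c).Nonempty := by
        rw [Finset.nonempty_iff_ne_empty]
        intro he
        have h2 := hcF.2
        rw [he, Finset.coe_empty, Submodule.span_empty] at h2
        exact bot_ne_top h2
      obtain ⟨p, hp⟩ := hne
      exact ⟨0, le_rfl, p, subset_convexHull ℝ _ (Finset.mem_coe.2 hp), by rw [hx0, zero_smul]⟩
    · obtain ⟨c', hc', hc'x⟩ := exists_inner_pos h0 hx0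
      have hm : 0 < ⟪c, x⟫ := lt_of_lt_of_le hc'x (hx c' hc')
      refine ⟨⟪c, x⟫, hm.le, ⟪c, x⟫⁻¹ • x, ?_, by rw [smul_inv_smul₀ hm.ne']⟩
      have hp1 : ⟪c, ⟪c, x⟫⁻¹ • x⟫ = 1 := by
        rw [real_inner_smul_right, inv_mul_cancel₀ hm.ne']
      refine mem_convexHull_tightSet hcF.1 ?_ hp1
      rw [convexHull_eq_setOf_inner_le_one h0]
      intro c'' hc''
      rw [real_inner_smul_right, inv_mul_le_iff₀ hm, mul_one]
      exact hx c'' hc''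
  · rintro ⟨t, ht, p, hp, rfl⟩ c' hc'
    have hpX : p ∈ convexHull ℝ (X : Set E) :=
      convexHull_mono (Finset.coe_subset.2 (tightSet_subset X c)) hp
    have hp1 : ⟪c, p⟫ = 1 := by
      refine le_antisymm (inner_le_one_of_mem_convexHull hcF.1 hpX) ?_
      -- `⟪c, ·⟫ = 1` on the tight set, hence `≥ 1` (indeed `= 1`) on its hull
      have h := inner_le_of_mem_convexHull (X := ((tightSet X c : Finset E) : Set E)) (c := -c)
        (m := -1) (fun y hy => by
          rw [inner_neg_left, (mem_tightSet.1 (Finset.mem_coe.1 hy)).2]) hp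
      rw [inner_neg_left] at h
      linarith
    rw [real_inner_smul_right, real_inner_smul_right, hp1, mul_one]
    exact mul_le_of_le_one_right ht (inner_le_one_of_mem_convexHull (mem_facetNormals.1 hc').1 hpX)

end MinkowskiWeyl

end Literature.Geometry.DiscreteGeometry
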